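import Mathlib
import Summits.ValiantsHypothesis.ValiantsHypothesis.Theorems.ProofCarryingSymmetryRestorationQPACFormula

/-!
# Route ProofCarryingSymmetry — crux `RestorationQP`, line `registered`: left combs of formulas modulo AC

Groundwork for the converse of the stability rung S3″ (a symmetric labelled circuit, laid out as a
straight-line Hrubeš–Tzameret circuit, has unfoldings invariant up to associativity/commutativity —
"B-core″", which makes the bet S2″ `stub_proofsToACEquiv` equivalent to the route's stability
statement L): unbounded fan-in gates are binarised as LEFT COMBS

* `combAdd [F₁, …, F_r] = ((F₁ + F₂) + F₃) + ⋯ + F_r` (`combAdd [F] = F`, junk `combAdd [] = 0`),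
  `combMul` likewise (junk `1`);
* values and renamings of folds (`eval_foldl_add`, `foldl_add_rename`, …);
* congruence: pointwise AC-equivalent lists have AC-equivalent combs (`acEq_combAdd_of_forall₂`);
* **permutation invariance**: combs of permuted lists are AC-equivalent (`acEq_combAdd_of_perm`,
  `acEq_combMul_of_perm`) — by induction on `List.Perm` with the accumulator lemmas
  `acEq_foldl_add_congr` / `foldl_add_add_acEq`.

* `combGate op l` — the binarisation of a gate over the list of its children (`t × 1` for a
  single child), with value / renaming / congruence / permutation lemmas;
* `binTree D g` — the binarised formula of a gate of a Dawar–Wilsenach labelled circuit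
  (children listed by `Finset.toList`), `binTree_eq`, and `eval_binTree : (binTree D g).eval = D.eval g`.

Registered helper: `proofsToACEquiv_aux_combPerm`.  Everything proved; no named facts.
-/

-- single-problem summit: `Summit.ValiantsHypothesis.ValiantsHypothesis.…` is the namespace by design (D-0017)
set_option linter.dupNamespace false

noncomputable section

namespace Summit.ValiantsHypothesis.ValiantsHypothesis.Theorems

namespace ACStability

open Literature.Computability.AlgebraicComplexity

universe u v w

variable {𝔽 : Type u} {X : Type v} {Y : Type w}

/-! ### Left combs -/

/-- The left `+`-comb of a list of formulas: `((F₁ + F₂) + F₃) + ⋯`; a singleton is itself; the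
empty comb is the junk leaf `0`. [folklore] -/
def combAdd [Zero 𝔽] : List (PIFormula 𝔽 X) → PIFormula 𝔽 X
  | [] => .const 0
  | F :: l => l.foldl .add F

/-- The left `×`-comb of a list of formulas; the empty comb is the junk leaf `1`. [folklore] -/
def combMul [One 𝔽] : List (PIFormula 𝔽 X) → PIFormula 𝔽 X
  | [] => .const 1
  | F :: l => l.foldl .mul F

/-- Unfolding of `combAdd` on a nonempty list. [folklore] -/
@[simp] theorem combAdd_cons [Zero 𝔽] (F : PIFormula 𝔽 X) (l : List (PIFormula 𝔽 X)) :
    combAdd (F :: l) = l.foldl .add F := rfl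

/-- Unfolding of `combMul` on a nonempty list. [folklore] -/
@[simp] theorem combMul_cons [One 𝔽] (F : PIFormula 𝔽 X) (l : List (PIFormula 𝔽 X)) :
    combMul (F :: l) = l.foldl .mul F := rfl

/-! ### Values and renamings -/

section Eval

variable [CommSemiring 𝔽]

/-- Value of a `+`-fold. [folklore] -/
theorem eval_foldl_add (a : PIFormula 𝔽 X) (l : List (PIFormula 𝔽 X)) :
    (l.foldl .add a).eval = a.eval + (l.map PIFormula.eval).sum := by
  induction l generalizing a with
  | nil => simp
  | cons F l ih => simp [ih, add_assoc]

/-- Value of a `×`-fold. [folklore] -/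
theorem eval_foldl_mul (a : PIFormula 𝔽 X) (l : List (PIFormula 𝔽 X)) :
    (l.foldl .mul a).eval = a.eval * (l.map PIFormula.eval).prod := by
  induction l generalizing a with
  | nil => simp
  | cons F l ih => simp [ih, mul_assoc]

end Eval

/-- Renaming a `+`-fold. [folklore] -/
theorem foldl_add_rename (f : X → Y) (a : PIFormula 𝔽 X) (l : List (PIFormula 𝔽 X)) :
    (l.foldl .add a).rename f = (l.map (PIFormula.rename f)).foldl .add (a.rename f) := by
  induction l generalizing a with
  | nil => rfl
  | cons F l ih => simp [ih, PIFormula.rename]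

/-- Renaming a `×`-fold. [folklore] -/
theorem foldl_mul_rename (f : X → Y) (a : PIFormula 𝔽 X) (l : List (PIFormula 𝔽 X)) :
    (l.foldl .mul a).rename f = (l.map (PIFormula.rename f)).foldl .mul (a.rename f) := by
  induction l generalizing a with
  | nil => rfl
  | cons F l ih => simp [ih, PIFormula.rename]

/-! ### Congruence and permutation invariance modulo AC -/

/-- `+`-folds respect AC-equivalence of the accumulator and of the list, pointwise. [folklore] -/
theorem acEq_foldl_add_congr {a a' : PIFormula 𝔽 X} {l l' : List (PIFormula 𝔽 X)}
    (ha : ACEq a a') (hl : List.Forall₂ ACEq l l') : ACEq (l.foldl .add a) (l'.foldl .add a') := by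
  induction hl generalizing a a' with
  | nil => exact ha
  | cons h _ ih => exact ih (ACEq.add_congr ha h)

/-- `×`-folds respect AC-equivalence of the accumulator and of the list, pointwise. [folklore] -/
theorem acEq_foldl_mul_congr {a a' : PIFormula 𝔽 X} {l l' : List (PIFormula 𝔽 X)}
    (ha : ACEq a a') (hl : List.Forall₂ ACEq l l') : ACEq (l.foldl .mul a) (l'.foldl .mul a') := by
  induction hl generalizing a a' with
  | nil => exact ha
  | cons h _ ih => exact ih (ACEq.mul_congr ha h)

/-- `Forall₂ ACEq` is reflexive. [folklore] -/
theorem forall₂_acEq_refl (l : List (PIFormula 𝔽 X)) : List.Forall₂ ACEq l l := by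
  induction l with
  | nil => exact List.Forall₂.nil
  | cons F l ih => exact List.Forall₂.cons (.refl F) ih

/-- Pulling the accumulator out of a `+`-fold: `foldl (+) (a + x) t ≈ a + foldl (+) x t`. [folklore] -/
theorem foldl_add_add_acEq (t : List (PIFormula 𝔽 X)) :
    ∀ a x : PIFormula 𝔽 X, ACEq (t.foldl .add (.add a x)) (.add a (t.foldl .add x)) := by
  induction t with
  | nil => intro a x; exact .refl _
  | cons y t ih =>
    intro a x
    simp only [List.foldl_cons]
    exact (acEq_foldl_add_congr (ACEq.add_assoc a x y).symm (forall₂_acEq_refl t)).trans (ih a (.add x y))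

/-- Pulling the accumulator out of a `×`-fold. [folklore] -/
theorem foldl_mul_mul_acEq (t : List (PIFormula 𝔽 X)) :
    ∀ a x : PIFormula 𝔽 X, ACEq (t.foldl .mul (.mul a x)) (.mul a (t.foldl .mul x)) := by
  induction t with
  | nil => intro a x; exact .refl _
  | cons y t ih =>
    intro a x
    simp only [List.foldl_cons]
    exact (acEq_foldl_mul_congr (ACEq.mul_assoc a x y).symm (forall₂_acEq_refl t)).trans (ih a (.mul x y))

/-- Pointwise AC-equivalent lists have AC-equivalent `+`-combs. [folklore] -/
theorem acEq_combAdd_of_forall₂ [Zero 𝔽] {l l' : List (PIFormula 𝔽 X)} (h : List.Forall₂ ACEq l l') :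
    ACEq (combAdd l) (combAdd l') := by
  cases h with
  | nil => exact .refl _
  | cons h hl => exact acEq_foldl_add_congr h hl

/-- Pointwise AC-equivalent lists have AC-equivalent `×`-combs. [folklore] -/
theorem acEq_combMul_of_forall₂ [One 𝔽] {l l' : List (PIFormula 𝔽 X)} (h : List.Forall₂ ACEq l l') :
    ACEq (combMul l) (combMul l') := by
  cases h with
  | nil => exact .refl _
  | cons h hl => exact acEq_foldl_mul_congr h hl

/-- **Permutation invariance of `+`-combs modulo AC.** [folklore] -/
theorem acEq_combAdd_of_perm [Zero 𝔽] {l l' : List (PIFormula 𝔽 X)} (h : l.Perm l') :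
    ACEq (combAdd l) (combAdd l') := by
  -- strengthen: also track that emptiness is preserved (automatic for `Perm`)
  induction h with
  | nil => exact .refl _
  | cons x h ih =>
    rename_i t t'
    cases t with
    | nil =>
      have : t' = [] := List.Perm.nil_eq h |>.symm
      subst this; exact .refl _
    | cons y t =>
      obtain ⟨y', t'', rfl⟩ : ∃ y' t'', t' = y' :: t'' := by
        cases t' with
        | nil => exact absurd (List.Perm.eq_nil h) (by simp)
        | cons y' t'' => exact ⟨y', t'', rfl⟩
      -- combAdd (x :: y :: t) = foldl (+) (x + y) t ≈ x + combAdd (y :: t), and likewise on the right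
      simp only [combAdd_cons, List.foldl_cons] at ih ⊢
      exact ((foldl_add_add_acEq t x y).trans (ACEq.add_congr (.refl x) ih)).trans
        (foldl_add_add_acEq t'' x y').symm
  | swap x y l =>
    simp only [combAdd_cons, List.foldl_cons]
    exact acEq_foldl_add_congr (ACEq.add_comm y x) (forall₂_acEq_refl l)
  | trans _ _ ih₁ ih₂ => exact ih₁.trans ih₂

/-- **Permutation invariance of `×`-combs modulo AC.** [folklore] -/
theorem acEq_combMul_of_perm [One 𝔽] {l l' : List (PIFormula 𝔽 X)} (h : l.Perm l') :
    ACEq (combMul l) (combMul l') := by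
  induction h with
  | nil => exact .refl _
  | cons x h ih =>
    rename_i t t'
    cases t with
    | nil =>
      have : t' = [] := List.Perm.nil_eq h |>.symm
      subst this; exact .refl _
    | cons y t =>
      obtain ⟨y', t'', rfl⟩ : ∃ y' t'', t' = y' :: t'' := by
        cases t' with
        | nil => exact absurd (List.Perm.eq_nil h) (by simp)
        | cons y' t'' => exact ⟨y', t'', rfl⟩
      simp only [combMul_cons, List.foldl_cons] at ih ⊢
      exact ((foldl_mul_mul_acEq t x y).trans (ACEq.mul_congr (.refl x) ih)).trans
        (foldl_mul_mul_acEq t'' x y').symm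
  | swap x y l =>
    simp only [combMul_cons, List.foldl_cons]
    exact acEq_foldl_mul_congr (ACEq.mul_comm y x) (forall₂_acEq_refl l)
  | trans _ _ ih₁ ih₂ => exact ih₁.trans ih₂

/-! ### Binarising a gate: the comb of its children -/

/-- The binarisation of an unbounded fan-in gate with operation `op` over the list of its
children's formulas: the left comb for `≥ 2` children, `t × 1` for a single child `t` (both `Σ`
and `Π` of a singleton are the element), the junk leaf `0` for no children. [folklore] -/
def combGate [Zero 𝔽] [One 𝔽] (op : PIFormula 𝔽 X → PIFormula 𝔽 X → PIFormula 𝔽 X) :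
    List (PIFormula 𝔽 X) → PIFormula 𝔽 X
  | [] => .const 0
  | [t] => .mul t (.const 1)
  | t :: t' :: l => l.foldl op (op t t')

/-- Value of a binarised `+`-gate. [folklore] -/
theorem eval_combGate_add [CommSemiring 𝔽] {l : List (PIFormula 𝔽 X)} (hl : l ≠ []) :
    (combGate .add l).eval = (l.map PIFormula.eval).sum := by
  match l, hl with
  | [t], _ => simp [combGate]
  | t :: t' :: l, _ => simp [combGate, eval_foldl_add, add_assoc]

/-- Value of a binarised `×`-gate. [folklore] -/
theorem eval_combGate_mul [CommSemiring 𝔽] {l : List (PIFormula 𝔽 X)} (hl : l ≠ []) :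
    (combGate .mul l).eval = (l.map PIFormula.eval).prod := by
  match l, hl with
  | [t], _ => simp [combGate]
  | t :: t' :: l, _ => simp [combGate, eval_foldl_mul, mul_assoc]

/-- Renaming a binarised `+`-gate. [folklore] -/
theorem combGate_add_rename [Zero 𝔽] [One 𝔽] (f : X → Y) (l : List (PIFormula 𝔽 X)) :
    (combGate .add l).rename f = combGate .add (l.map (PIFormula.rename f)) := by
  match l with
  | [] => rfl
  | [t] => rfl
  | t :: t' :: l => simp [combGate, foldl_add_rename, PIFormula.rename]

/-- Renaming a binarised `×`-gate. [folklore] -/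
theorem combGate_mul_rename [Zero 𝔽] [One 𝔽] (f : X → Y) (l : List (PIFormula 𝔽 X)) :
    (combGate .mul l).rename f = combGate .mul (l.map (PIFormula.rename f)) := by
  match l with
  | [] => rfl
  | [t] => rfl
  | t :: t' :: l => simp [combGate, foldl_mul_rename, PIFormula.rename]

/-- Binarised `+`-gates of pointwise AC-equivalent lists are AC-equivalent. [folklore] -/
theorem acEq_combGate_add_of_forall₂ [Zero 𝔽] [One 𝔽] {l l' : List (PIFormula 𝔽 X)}
    (h : List.Forall₂ ACEq l l') : ACEq (combGate .add l) (combGate .add l') := by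
  match l, l', h with
  | [], [], _ => exact .refl _
  | [t], [t'], .cons ht .nil => exact ACEq.mul_congr ht (.refl _)
  | _ :: _ :: _, _ :: _ :: _, .cons ht (.cons ht' hl) => exact acEq_foldl_add_congr (ACEq.add_congr ht ht') hl

/-- Binarised `×`-gates of pointwise AC-equivalent lists are AC-equivalent. [folklore] -/
theorem acEq_combGate_mul_of_forall₂ [Zero 𝔽] [One 𝔽] {l l' : List (PIFormula 𝔽 X)}
    (h : List.Forall₂ ACEq l l') : ACEq (combGate .mul l) (combGate .mul l') := by
  match l, l', h with
  | [], [], _ => exact .refl _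
  | [t], [t'], .cons ht .nil => exact ACEq.mul_congr ht (.refl _)
  | _ :: _ :: _, _ :: _ :: _, .cons ht (.cons ht' hl) => exact acEq_foldl_mul_congr (ACEq.mul_congr ht ht') hl

/-- **Binarised `+`-gates of permuted lists are AC-equivalent.** [folklore] -/
theorem acEq_combGate_add_of_perm [Zero 𝔽] [One 𝔽] {l l' : List (PIFormula 𝔽 X)} (h : l.Perm l') :
    ACEq (combGate .add l) (combGate .add l') := by
  match l, l' with
  | [], l' => rw [List.Perm.nil_eq h]; exact .refl _
  | [t], l' => rw [← List.singleton_perm.1 h]; exact .refl _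
  | t :: t' :: l, [] => exact absurd (List.Perm.eq_nil h) (by simp)
  | t :: t' :: l, [u] => exact absurd (List.Perm.length_eq h) (by simp)
  | t :: t' :: l, u :: u' :: l' =>
    have := acEq_combAdd_of_perm h
    simpa [combAdd, combGate] using this

/-- **Binarised `×`-gates of permuted lists are AC-equivalent.** [folklore] -/
theorem acEq_combGate_mul_of_perm [Zero 𝔽] [One 𝔽] {l l' : List (PIFormula 𝔽 X)} (h : l.Perm l') :
    ACEq (combGate .mul l) (combGate .mul l') := by
  match l, l' with
  | [], l' => rw [List.Perm.nil_eq h]; exact .refl _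
  | [t], l' => rw [← List.singleton_perm.1 h]; exact .refl _
  | t :: t' :: l, [] => exact absurd (List.Perm.eq_nil h) (by simp)
  | t :: t' :: l, [u] => exact absurd (List.Perm.length_eq h) (by simp)
  | t :: t' :: l, u :: u' :: l' =>
    have := acEq_combMul_of_perm h
    simpa [combMul, combGate] using this

/-! ### The binarised formula of a gate of a labelled circuit -/

section BinTree

variable {Yo : Type*} {G : Type*} [Zero 𝔽] [One 𝔽]

/-- **The binarised formula of a gate** of a Dawar–Wilsenach labelled circuit: leaves are leaves,
an internal gate is the binarisation (`combGate`) of the list `(children g).toList` of the formulas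
of its children (well-founded recursion along the wires). [folklore] -/
def binTree (D : LabelledArithCircuit 𝔽 X Yo G) : G → PIFormula 𝔽 X :=
  D.wf.fix fun g rec =>
    match D.label g with
    | .var x => .var x
    | .const c => .const c
    | .add => combGate .add ((D.children g).toList.attach.map fun h => rec h.1 (Finset.mem_toList.1 h.2))
    | .mul => combGate .mul ((D.children g).toList.attach.map fun h => rec h.1 (Finset.mem_toList.1 h.2))

/-- `attach`-then-`map` through the value is `map`. [folklore] -/
theorem attach_map_comp_val {α β : Type*} (l : List α) (f : α → β) :
    (l.attach.map fun h => f h.1) = l.map f := by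
  conv_rhs => rw [← List.attach_map_subtype_val l]
  rw [List.map_map]
  rfl

/-- The defining equations of `binTree`. [folklore] -/
theorem binTree_eq (D : LabelledArithCircuit 𝔽 X Yo G) (g : G) :
    binTree D g =
      match D.label g with
      | .var x => .var x
      | .const c => .const c
      | .add => combGate .add ((D.children g).toList.map (binTree D))
      | .mul => combGate .mul ((D.children g).toList.map (binTree D)) := by
  conv_lhs => rw [binTree, WellFounded.fix_eq]
  change (match D.label g with
      | .var x => PIFormula.var x
      | .const c => PIFormula.const c
      | .add => combGate PIFormula.add ((D.children g).toList.attach.map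
          fun h : {h // h ∈ (D.children g).toList} => binTree D h.1)
      | .mul => combGate PIFormula.mul ((D.children g).toList.attach.map
          fun h : {h // h ∈ (D.children g).toList} => binTree D h.1)) = _
  simp only [attach_map_comp_val]

/-- A variable gate binarises to the variable. [folklore] -/
theorem binTree_of_var (D : LabelledArithCircuit 𝔽 X Yo G) {g : G} {x : X} (h : D.label g = .var x) :
    binTree D g = .var x := by
  rw [binTree_eq, h]

/-- A constant gate binarises to the constant. [folklore] -/
theorem binTree_of_const (D : LabelledArithCircuit 𝔽 X Yo G) {g : G} {c : 𝔽} (h : D.label g = .const c) :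
    binTree D g = .const c := by
  rw [binTree_eq, h]

/-- A `+`-gate binarises to the comb of its children. [folklore] -/
theorem binTree_of_add (D : LabelledArithCircuit 𝔽 X Yo G) {g : G} (h : D.label g = .add) :
    binTree D g = combGate .add ((D.children g).toList.map (binTree D)) := by
  rw [binTree_eq, h]

/-- A `×`-gate binarises to the comb of its children. [folklore] -/
theorem binTree_of_mul (D : LabelledArithCircuit 𝔽 X Yo G) {g : G} (h : D.label g = .mul) :
    binTree D g = combGate .mul ((D.children g).toList.map (binTree D)) := by
  rw [binTree_eq, h]

/-- **The binarised formula of a gate computes the gate** (over a commutative semiring).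
[folklore] -/
theorem eval_binTree {K : Type u} [CommSemiring K] (D : LabelledArithCircuit K X Yo G) :
    ∀ g, (binTree D g).eval = D.eval g := by
  intro g
  induction g using D.wf.induction with
  | h g ih =>
    rcases hl : D.label g with x | c | _ | _
    · rw [binTree_of_var D hl, D.eval_of_label_var hl]; rfl
    · rw [binTree_of_const D hl, D.eval_of_label_const hl]; rfl
    · have hne : (D.children g).toList.map (binTree D) ≠ [] := by
        have : D.children g ≠ ∅ := fun he => by
          have := (D.isInput_iff g).2 he; simp [hl, CircuitLabel.IsInput] at this
        simpa [Finset.toList_eq_nil] using this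
      rw [binTree_of_add D hl, eval_combGate_add hne, D.eval_of_label_add hl, List.map_map,
        ← Finset.sum_map_toList]
      refine congrArg List.sum (List.map_congr_left fun h hh => ?_)
      exact ih h (Finset.mem_toList.1 hh)
    · have hne : (D.children g).toList.map (binTree D) ≠ [] := by
        have : D.children g ≠ ∅ := fun he => by
          have := (D.isInput_iff g).2 he; simp [hl, CircuitLabel.IsInput] at this
        simpa [Finset.toList_eq_nil] using this
      rw [binTree_of_mul D hl, eval_combGate_mul hne, D.eval_of_label_mul hl, List.map_map,
        ← Finset.prod_map_toList]
      refine congrArg List.prod (List.map_congr_left fun h hh => ?_)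
      exact ih h (Finset.mem_toList.1 hh)

end BinTree

end ACStability

open Literature.Computability.AlgebraicComplexity in
/-- **Combs of permuted lists are AC-equivalent** (registered helper toward the converse of S3″ /
honesty of stub S2″ `stub_proofsToACEquiv`, crux `RestorationQP`): binarising an unbounded fan-in
`+`-gate as a left comb does not depend, modulo associativity and commutativity, on the order of the
children. [folklore] -/
theorem proofsToACEquiv_aux_combPerm : ∀ (n : ℕ) (l l' : List (PIFormula ℂ (Fin n × Fin n))), l.Perm l' → ACStability.ACEq (ACStability.combAdd l) (ACStability.combAdd l') := by
  intro n l l' h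
  exact ACStability.acEq_combAdd_of_perm h

end Summit.ValiantsHypothesis.ValiantsHypothesis.Theorems

end
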